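import Summits.BirchSwinnertonDyer.Rank1Residual.GaloisImage.TameThreeTorsionValuation
import Mathlib.FieldTheory.IsAlgClosed.Basic
import HarnessLib

/-!
# Valuations of the `9`-torsion abscissae on a Kodaira-`III`-shaped model at `3`
# (cell `b2b-bsdres`, team n1011, seat p14 gen 2, OWNERS row T-b9 'tame tower at 3', step S2)

HONEST FRAMING (cell `b2b-bsdres`, run/shared/lean/b2b/bsd-rank1-residual/, verbatim in every
file): the goal of the cell is to DELETE the COMBINATION-SHAPED residual classes of the
Birch–Swinnerton-Dyer formula for ALL analytic-rank `≤ 1` elliptic curves over `ℚ` — "full BSD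
formula for every rank `≤ 1` curve in class `C`" assembled STRICTLY from published theorems — so
that the rank-`≤ 1` remainder becomes exactly the CONSTRUCTION-SHAPED classes, which are TYPED
(missing-input `Prop`s), NOT attempted. This is not "finishing BSD". Team n1011 (N10 / N11, the
additive block X4 ∧ `p = 3`): research route on the CONSTRUCTION-SHAPED class X4; no claim beyond the
stated classes; nothing is booked. Theorems only (no definition, no named fact).

## What this file proves (step S2 of `cells/n1011/skel/T-b9-tame-tower.md`)

Let `W` be a Weierstrass equation over `ℚ̄` whose coefficients are **`III`-shaped at the place
`v` over `3`**: `v(b₂) ≤ v(3)`, `v(b₄) ≤ v(3)`, `v(b₆) ≤ v(3)²`, `v(b₈) = v(3)²` (multiplicative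
notation, `v(3) < 1`; e.g. the image in `ℚ̄` of an integral model with `3 ∣ b₂`, `3 ∥ b₄`, `9 ∣ b₆`,
file `TameThreeTorsionValuation`).  If `x, x' ∈ ℚ̄` satisfy the multiplication-by-`3` relation
`x' · ψ₃(x)² = Φ₃(x)` (so `x = x(Q)`, `x' = x(3Q)` for a point `Q` with `3Q ≠ O`, tree theorem
`WeierstrassCurve.mul_eval_ΨSq_of_zsmul_eq`) and `v(3) ≤ v(x')³`, `v(x') ≤ 1` (the abscissa of a
point of order `3`, by S1), then

* `valuation_pow_nine_eq_of_mul_rel` — **`v(x)⁹ = v(x') · v(3)⁴`**.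

So above a unit `3`-torsion abscissa the `9`-torsion abscissae have `v = 4/9`, above one with
`v(x')³ = v(3)` they have **`v = 13/27`** (CASE A), and in CASE B (`v(x')⁴ = v(3)`) **`v = 17/36`**
— the patterns {4/9, 13/27} and {17/36} of the research note (all 3 134 Kodaira-III cells).  Proof:
`Φ₃(X) − x'ψ₃(X)² = X⁹ + c₈X⁸ + ⋯ + c₁X + c₀` with explicit `cᵢ ∈ ℤ[b₂,b₄,b₆,b₈,x']`
(`eval_Φ_three_sub_mul_Ψ₃_sq`), `c₀ = −x'b₈² + (b₆³ − b₄b₆b₈)` dominated by `x'b₈²`, and every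
middle coefficient STRICTLY above the Newton segment (`v(cᵢ)²⁷ ≤ v(3)^{27kᵢ} < v(3)^{13(9−i)}`,
`k = (4,4,3,3,2,2,2,2)`); a generic dominant-term lemma for a monic degree-`9` relation
(`valuation_eq_of_monic_relation_nine`) then pins `v(x)`.  The `9`-th root `β` of `v(x')v(3)⁴`
in the value group is taken as `v(λ)`, `λ⁹ = x'b₈²` in `ℚ̄`.  Step S2 only; no tower claimed here.

References: Silverman *AEC* Ex. 3.7 (d) (`x(3Q) ψ₃² = Φ₃`); Serre 1972 §1.9–1.11 (the height-2
analogue, tree file `SupersingularSqTorsionValuationProofs`).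
-/

noncomputable section

open scoped Classical

open Polynomial WeierstrassCurve

namespace Summit.BirchSwinnertonDyer.Rank1Residual.GaloisImage

open Literature.NumberTheory.EllipticCurves

/-! ### §1 A dominant-term lemma for a monic relation of degree `9` -/

section Generic

variable {L : Type*} [Field L] {Γ₀ : Type*} [LinearOrderedCommGroupWithZero Γ₀] (w : Valuation L Γ₀)

/-- **Newton polygon with one segment, degree `9`.** If `x⁹ + c₈x⁸ + ⋯ + c₁x + c₀ = 0` in a valued
field, `w(c₀) = β⁹` and `w(cᵢ) < β^{9-i}` for `1 ≤ i ≤ 8` (`β ≠ 0`), then `w(x) = β`: for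
`w(x) > β` the top term dominates, for `w(x) < β` the constant term does. -/
theorem valuation_eq_of_monic_relation_nine {x c0 c1 c2 c3 c4 c5 c6 c7 c8 : L} {β : Γ₀}
    (hβ : β ≠ 0) (h0 : w c0 = β ^ 9) (h1 : w c1 < β ^ 8) (h2 : w c2 < β ^ 7) (h3 : w c3 < β ^ 6)
    (h4 : w c4 < β ^ 5) (h5 : w c5 < β ^ 4) (h6 : w c6 < β ^ 3) (h7 : w c7 < β ^ 2)
    (h8 : w c8 < β ^ 1)
    (hrel : x ^ 9 + (c8 * x ^ 8 + c7 * x ^ 7 + c6 * x ^ 6 + c5 * x ^ 5 + c4 * x ^ 4 + c3 * x ^ 3 +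
      c2 * x ^ 2 + c1 * x + c0) = 0) :
    w x = β := by
  set u := w x with hu
  -- a middle term `cᵢ xⁱ` is `< max(u, β)^9`-ish; we treat the two regimes separately
  rcases lt_trichotomy u β with hlt | heq | hgt
  · -- `c₀` dominates
    exfalso
    have hule : u ≤ β := hlt.le
    have hmid : ∀ {c : L} {i : ℕ}, w c < β ^ (9 - i) → i ≤ 9 → w (c * x ^ i) < β ^ 9 := by
      intro c i hc hi
      rw [map_mul, map_pow]
      calc w c * u ^ i ≤ w c * β ^ i := mul_le_mul' le_rfl (pow_le_pow_left₀ zero_le hule i)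
        _ < β ^ (9 - i) * β ^ i := mul_lt_mul_right_of_ne_zero' (pow_ne_zero _ hβ) hc
        _ = β ^ 9 := by rw [← pow_add, Nat.sub_add_cancel hi]
    have htop : w (x ^ 9) < β ^ 9 := by
      rw [map_pow]; exact pow_lt_pow_left₀ hlt zero_le (by norm_num)
    have hr : w (x ^ 9 + (c8 * x ^ 8 + c7 * x ^ 7 + c6 * x ^ 6 + c5 * x ^ 5 + c4 * x ^ 4 +
        c3 * x ^ 3 + c2 * x ^ 2 + c1 * x)) < w c0 := by
      rw [h0]
      refine Valuation.map_add_lt _ htop ?_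
      refine Valuation.map_add_lt _ (Valuation.map_add_lt _ (Valuation.map_add_lt _
        (Valuation.map_add_lt _ (Valuation.map_add_lt _ (Valuation.map_add_lt _
        (Valuation.map_add_lt _ (hmid h8 (by norm_num)) (hmid h7 (by norm_num)))
        (hmid h6 (by norm_num))) (hmid h5 (by norm_num))) (hmid h4 (by norm_num)))
        (hmid h3 (by norm_num))) (hmid h2 (by norm_num))) ?_
      simpa using hmid (i := 1) (by simpa using h1) (by norm_num)
    refine false_of_dominant w ?_ hr
    rw [← hrel]; ring
  · exact heq
  · -- `x⁹` dominates
    exfalso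
    have hu0 : u ≠ 0 := by rintro h; rw [h] at hgt; exact not_lt_zero hgt
    have hmid : ∀ {c : L} {i : ℕ}, w c < β ^ (9 - i) → i < 9 → w (c * x ^ i) < u ^ 9 := by
      intro c i hc hi
      rw [map_mul, map_pow]
      have h9 : 9 = (9 - i) + i := (Nat.sub_add_cancel hi.le).symm
      calc w c * u ^ i < β ^ (9 - i) * u ^ i := mul_lt_mul_right_of_ne_zero' (pow_ne_zero _ hu0) hc
        _ ≤ u ^ (9 - i) * u ^ i := mul_le_mul' (pow_le_pow_left₀ zero_le hgt.le _) le_rfl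
        _ = u ^ 9 := by rw [← pow_add, ← h9]
    have hmid' : ∀ {c : L} {i : ℕ}, w c < β ^ (9 - i) → i < 9 → w (c * x ^ i) < w (x ^ 9) := by
      intro c i hc hi; rw [map_pow]; exact hmid hc hi
    have h0' : w c0 < w (x ^ 9) := by
      rw [map_pow, h0]; exact pow_lt_pow_left₀ hgt zero_le (by norm_num)
    have hr : w (c8 * x ^ 8 + c7 * x ^ 7 + c6 * x ^ 6 + c5 * x ^ 5 + c4 * x ^ 4 + c3 * x ^ 3 +
        c2 * x ^ 2 + c1 * x + c0) < w (x ^ 9) := by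
      refine Valuation.map_add_lt _ ?_ h0'
      refine Valuation.map_add_lt _ (Valuation.map_add_lt _ (Valuation.map_add_lt _
        (Valuation.map_add_lt _ (Valuation.map_add_lt _ (Valuation.map_add_lt _
        (Valuation.map_add_lt _ (hmid' h8 (by norm_num)) (hmid' h7 (by norm_num)))
        (hmid' h6 (by norm_num))) (hmid' h5 (by norm_num))) (hmid' h4 (by norm_num)))
        (hmid' h3 (by norm_num))) (hmid' h2 (by norm_num))) ?_
      simpa using hmid' (i := 1) (by simpa using h1) (by norm_num)
    exact false_of_dominant w hrel hr

end Generic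

/-! ### §2 The multiplication-by-`3` relation, expanded -/

variable (W : WeierstrassCurve (AlgebraicClosure ℚ))

/-- **`Φ₃(x) − x'ψ₃(x)²` expanded in powers of `x`** (Mathlib: `Φ₃ = Xψ₃² − preΨ₄·Ψ₂Sq`,
`ψ₃ = 3X⁴ + b₂X³ + 3b₄X² + 3b₆X + b₈`, `preΨ₄`, `Ψ₂Sq = 4X³ + b₂X² + 2b₄X + b₆`): a monic
polynomial of degree `9` in `x` with the displayed coefficients `c₈, …, c₀ ∈ ℤ[b₂, b₄, b₆, b₈, x']`.
[folklore] -/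
theorem eval_Φ_three_sub_mul_Ψ₃_sq (x x' : AlgebraicClosure ℚ) :
    (W.Φ 3).eval x - x' * (W.Ψ₃.eval x) ^ 2 =
      x ^ 9 + ((-9 * x') * x ^ 8 + (-6 * W.b₄ - 6 * W.b₂ * x') * x ^ 7 +
        (-24 * W.b₆ - 18 * W.b₄ * x' - W.b₂ * W.b₄ - W.b₂ ^ 2 * x') * x ^ 6 +
        (-34 * W.b₈ - 18 * W.b₆ * x' - W.b₄ ^ 2 - 5 * W.b₂ * W.b₆ - 6 * W.b₂ * W.b₄ * x') * x ^ 5 +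
        (-6 * W.b₈ * x' - 3 * W.b₄ * W.b₆ - 9 * W.b₄ ^ 2 * x' - 12 * W.b₂ * W.b₈ -
          6 * W.b₂ * W.b₆ * x') * x ^ 4 +
        (3 * W.b₆ ^ 2 - 18 * W.b₄ * W.b₈ - 18 * W.b₄ * W.b₆ * x' - 2 * W.b₂ * W.b₈ * x' +
          W.b₂ * W.b₄ * W.b₆ - W.b₂ ^ 2 * W.b₈) * x ^ 3 +
        (-4 * W.b₆ * W.b₈ - 9 * W.b₆ ^ 2 * x' - 6 * W.b₄ * W.b₈ * x' + 2 * W.b₄ ^ 2 * W.b₆ +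
          W.b₂ * W.b₆ ^ 2 - 3 * W.b₂ * W.b₄ * W.b₈) * x ^ 2 +
        (W.b₈ ^ 2 - 6 * W.b₆ * W.b₈ * x' + 3 * W.b₄ * W.b₆ ^ 2 - 2 * W.b₄ ^ 2 * W.b₈ -
          W.b₂ * W.b₆ * W.b₈) * x +
        (-(x' * W.b₈ ^ 2) + (W.b₆ ^ 3 - W.b₄ * W.b₆ * W.b₈))) := by
  rw [WeierstrassCurve.Φ_three]
  simp only [WeierstrassCurve.Ψ₃, WeierstrassCurve.preΨ₄, WeierstrassCurve.Ψ₂Sq, eval_sub,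
    eval_mul, eval_add, eval_pow, eval_X, eval_C, eval_ofNat, map_sub, map_mul, map_pow]
  ring

/-! ### §3–§4 The valuation of the `9`-torsion abscissae -/

/-- **S2: `v(x)⁹ = v(x') · v(3)⁴` for the abscissa `x` of a point `Q` with `3Q = P = (x', y')` of
order `3`**, on a `III`-shaped equation over `ℚ̄` (`v(b₂), v(b₄) ≤ v(3)`, `v(b₆) ≤ v(3)²`,
`v(b₈) = v(3)²`), given the multiplication-by-`3` relation `x' ψ₃(x)² = Φ₃(x)` and
`v(3) ≤ v(x')³`, `v(x') ≤ 1`.  The constant term of `Φ₃ − x'ψ₃²` is `−x'b₈² + (b₆³ − b₄b₆b₈)`,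
of valuation exactly `v(x')v(3)⁴`; every middle coefficient `cᵢ` satisfies
`v(cᵢ)²⁷ ≤ v(3)^{27kᵢ} < v(3)^{13(9−i)} ≤ (v(x')v(3)⁴)^{3(9−i)}` with `k = (4,4,3,3,2,2,1,1)`, i.e.
`v(cᵢ) < β^{9−i}` for `β⁹ = v(x')v(3)⁴` (`β = v(λ)`, `λ⁹ = x'b₈²` in `ℚ̄`), and
`valuation_eq_of_monic_relation_nine` applies. [folklore] -/
theorem valuation_pow_nine_eq_of_mul_rel
    (hb2 : (placeOver 3).valuation W.b₂ ≤ (placeOver 3).valuation (3 : AlgebraicClosure ℚ))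
    (hb4 : (placeOver 3).valuation W.b₄ ≤ (placeOver 3).valuation (3 : AlgebraicClosure ℚ))
    (hb6 : (placeOver 3).valuation W.b₆ ≤ (placeOver 3).valuation (3 : AlgebraicClosure ℚ) ^ 2)
    (hb8 : (placeOver 3).valuation W.b₈ = (placeOver 3).valuation (3 : AlgebraicClosure ℚ) ^ 2)
    {x x' : AlgebraicClosure ℚ} (hrel : x' * (W.Ψ₃.eval x) ^ 2 = (W.Φ 3).eval x)
    (hx'1 : (placeOver 3).valuation x' ≤ 1)
    (hx'3 : (placeOver 3).valuation (3 : AlgebraicClosure ℚ) ≤ (placeOver 3).valuation x' ^ 3) :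
    (placeOver 3).valuation x ^ 9 =
      (placeOver 3).valuation x' * (placeOver 3).valuation (3 : AlgebraicClosure ℚ) ^ 4 := by
  set v := (placeOver 3).valuation with hv
  set t := v (3 : AlgebraicClosure ℚ) with ht
  have ht1 : t < 1 := valuation_three_lt_one
  have ht0 : t ≠ 0 := valuation_three_ne_zero
  have htpos : 0 < t := zero_lt_iff.mpr ht0
  set w := v x' with hw
  -- `w > t` (from `t ≤ w³ ≤ w ≤ 1`, `t < 1`)
  have hw3le : w ^ 3 ≤ w := by simpa using pow_le_pow_of_le_one' hx'1 (show 1 ≤ 3 by norm_num)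
  have htw : t < w := by
    rcases (hx'3.trans hw3le).lt_or_eq with h | h
    · exact h
    · exfalso
      have h3 : w ^ 3 = w := le_antisymm hw3le (h ▸ hx'3)
      have hw0 : w ≠ 0 := by rw [← h]; exact ht0
      have : w ^ 2 = 1 := by
        have e : w ^ 2 * w = 1 * w := by rw [← pow_succ, h3, one_mul]
        exact mul_right_cancel₀ hw0 e
      have hw1 : w = 1 := by
        rcases lt_trichotomy w 1 with hl | he | hg
        · exact absurd this (ne_of_lt (pow_lt_one₀ zero_le hl two_ne_zero))
        · exact he
        · exact absurd this (ne_of_gt (one_lt_pow₀ hg two_ne_zero))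
      rw [h, hw1] at ht1; exact lt_irrefl _ ht1
  have hw0 : w ≠ 0 := ne_of_gt (htpos.trans htw)
  -- the target value `B = w t⁴` and a ninth root `β = v(λ)`, `λ⁹ = x' b₈²`
  set B := w * t ^ 4 with hB
  have hB0 : B ≠ 0 := mul_ne_zero hw0 (pow_ne_zero _ ht0)
  obtain ⟨lam, hlam⟩ := IsAlgClosed.exists_pow_nat_eq (x' * W.b₈ ^ 2) (by norm_num : 0 < 9)
  set β := v lam with hβ
  have hβ9 : β ^ 9 = B := by
    rw [hβ, ← map_pow, hlam, map_mul, map_pow, hb8, ← pow_mul]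
  have hβ0 : β ≠ 0 := by
    intro h0; rw [h0, zero_pow (by norm_num)] at hβ9; exact hB0 hβ9.symm
  -- `t¹³ ≤ B³`
  have hB3 : t ^ 13 ≤ B ^ 3 := by
    calc t ^ 13 = t * t ^ 12 := by rw [← pow_succ']
      _ ≤ w ^ 3 * (t ^ 4) ^ 3 := by rw [← pow_mul]; exact mul_le_mul' hx'3 le_rfl
      _ = B ^ 3 := by rw [hB, mul_pow]
  -- from a bound `v(c) ≤ t^k` with `13 m < 27 k` to `v(c) < β^m`
  have bound : ∀ {c : AlgebraicClosure ℚ} {k m : ℕ}, v c ≤ t ^ k → 13 * m < 27 * k →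
      v c < β ^ m := by
    intro c k m hc hkm
    have h1 : v c ^ 27 ≤ t ^ (k * 27) := by rw [pow_mul]; exact pow_le_pow_left₀ zero_le hc 27
    have h2 : t ^ (k * 27) < t ^ (13 * m) := pow_lt_pow_right_of_lt_one₀ htpos ht1 (by omega)
    have h3 : t ^ (13 * m) ≤ (β ^ m) ^ 27 := by
      calc t ^ (13 * m) = (t ^ 13) ^ m := pow_mul t 13 m
        _ ≤ (B ^ 3) ^ m := pow_le_pow_left₀ zero_le hB3 m
        _ = (β ^ m) ^ 27 := by rw [← hβ9, ← pow_mul, ← pow_mul, ← pow_mul]; ring_nf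
    exact lt_of_pow_lt_pow_left₀ 27 zero_le (h1.trans_lt (h2.trans_le h3))
  -- atom bounds
  have hnat : ∀ n : ℕ, v (n : AlgebraicClosure ℚ) ≤ t ^ 0 := fun n ↦ by
    rw [pow_zero]; exact ((placeOver 3).valuation_le_one_iff _).mpr (natCast_mem (placeOver 3) n)
  have hnat3 : ∀ n : ℕ, v ((3 * n : ℕ) : AlgebraicClosure ℚ) ≤ t ^ 1 := fun n ↦ by
    rw [Nat.cast_mul, map_mul, pow_one, Nat.cast_ofNat]
    calc v 3 * v (n : AlgebraicClosure ℚ) ≤ t * t ^ 0 := mul_le_mul' le_rfl (hnat n)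
      _ = t := by rw [pow_zero, mul_one]
  have h2 : v (2 : AlgebraicClosure ℚ) ≤ t ^ 0 := by simpa using hnat 2
  have h4 : v (4 : AlgebraicClosure ℚ) ≤ t ^ 0 := by simpa using hnat 4
  have h5 : v (5 : AlgebraicClosure ℚ) ≤ t ^ 0 := by simpa using hnat 5
  have h34 : v (34 : AlgebraicClosure ℚ) ≤ t ^ 0 := by simpa using hnat 34
  have h3 : v (3 : AlgebraicClosure ℚ) ≤ t ^ 1 := by simpa using hnat3 1
  have h6 : v (6 : AlgebraicClosure ℚ) ≤ t ^ 1 := by simpa using hnat3 2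
  have h9 : v (9 : AlgebraicClosure ℚ) ≤ t ^ 1 := by simpa using hnat3 3
  have h12 : v (12 : AlgebraicClosure ℚ) ≤ t ^ 1 := by simpa using hnat3 4
  have h18 : v (18 : AlgebraicClosure ℚ) ≤ t ^ 1 := by simpa using hnat3 6
  have h24 : v (24 : AlgebraicClosure ℚ) ≤ t ^ 1 := by simpa using hnat3 8
  have hb2' : v W.b₂ ≤ t ^ 1 := by rwa [pow_one]
  have hb4' : v W.b₄ ≤ t ^ 1 := by rwa [pow_one]
  have hb8' : v W.b₈ ≤ t ^ 2 := hb8.le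
  have hx'0 : v x' ≤ t ^ 0 := by rwa [pow_zero]
  -- monomial calculus
  have hmul : ∀ {a b : AlgebraicClosure ℚ} {i j : ℕ}, v a ≤ t ^ i → v b ≤ t ^ j →
      v (a * b) ≤ t ^ (i + j) := by
    intro a b i j ha hb; rw [map_mul, pow_add]; exact mul_le_mul' ha hb
  have hpw : ∀ {a : AlgebraicClosure ℚ} {i : ℕ} (n : ℕ), v a ≤ t ^ i → v (a ^ n) ≤ t ^ (i * n) := by
    intro a i n ha; rw [map_pow, pow_mul]; exact pow_le_pow_left₀ zero_le ha n
  have hng : ∀ {a : AlgebraicClosure ℚ} {i : ℕ}, v a ≤ t ^ i → v (-a) ≤ t ^ i := by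
    intro a i ha; rwa [Valuation.map_neg]
  have hwk : ∀ {a : AlgebraicClosure ℚ} {i k : ℕ}, v a ≤ t ^ i → k ≤ i → v a ≤ t ^ k := by
    intro a i k ha hk; exact ha.trans (pow_le_pow_of_le_one' ht1.le hk)
  -- coefficient bounds `v(cᵢ) ≤ t^{kᵢ}`, `k = (4,4,3,3,2,2,1,1)` for `i = 1..8`
  have hc8 : v (-9 * x') ≤ t ^ 1 := hwk (hmul (hng h9) hx'0) (by norm_num)
  have hc7 : v (-6 * W.b₄ - 6 * W.b₂ * x') ≤ t ^ 1 :=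
    Valuation.map_sub_le _ (hwk (hmul (hng h6) hb4') (by norm_num))
      (hwk (hmul (hmul h6 hb2') hx'0) (by norm_num))
  have hc6 : v (-24 * W.b₆ - 18 * W.b₄ * x' - W.b₂ * W.b₄ - W.b₂ ^ 2 * x') ≤ t ^ 2 :=
    Valuation.map_sub_le _ (Valuation.map_sub_le _ (Valuation.map_sub_le _
      (hwk (hmul (hng h24) hb6) (by norm_num)) (hwk (hmul (hmul h18 hb4') hx'0) (by norm_num)))
      (hwk (hmul hb2' hb4') (by norm_num))) (hwk (hmul (hpw 2 hb2') hx'0) (by norm_num))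
  have hc5 : v (-34 * W.b₈ - 18 * W.b₆ * x' - W.b₄ ^ 2 - 5 * W.b₂ * W.b₆ - 6 * W.b₂ * W.b₄ * x') ≤
      t ^ 2 :=
    Valuation.map_sub_le _ (Valuation.map_sub_le _ (Valuation.map_sub_le _ (Valuation.map_sub_le _
      (hwk (hmul (hng h34) hb8') (by norm_num)) (hwk (hmul (hmul h18 hb6) hx'0) (by norm_num)))
      (hwk (hpw 2 hb4') (by norm_num))) (hwk (hmul (hmul h5 hb2') hb6) (by norm_num)))
      (hwk (hmul (hmul (hmul h6 hb2') hb4') hx'0) (by norm_num))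
  have hc4 : v (-6 * W.b₈ * x' - 3 * W.b₄ * W.b₆ - 9 * W.b₄ ^ 2 * x' - 12 * W.b₂ * W.b₈ -
      6 * W.b₂ * W.b₆ * x') ≤ t ^ 3 :=
    Valuation.map_sub_le _ (Valuation.map_sub_le _ (Valuation.map_sub_le _ (Valuation.map_sub_le _
      (hwk (hmul (hmul (hng h6) hb8') hx'0) (by norm_num)) (hwk (hmul (hmul h3 hb4') hb6) (by norm_num)))
      (hwk (hmul (hmul h9 (hpw 2 hb4')) hx'0) (by norm_num))) (hwk (hmul (hmul h12 hb2') hb8') (by norm_num)))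
      (hwk (hmul (hmul (hmul h6 hb2') hb6) hx'0) (by norm_num))
  have hc3 : v (3 * W.b₆ ^ 2 - 18 * W.b₄ * W.b₈ - 18 * W.b₄ * W.b₆ * x' - 2 * W.b₂ * W.b₈ * x' +
      W.b₂ * W.b₄ * W.b₆ - W.b₂ ^ 2 * W.b₈) ≤ t ^ 3 :=
    Valuation.map_sub_le _ (Valuation.map_add_le _ (Valuation.map_sub_le _ (Valuation.map_sub_le _
      (Valuation.map_sub_le _
      (hwk (hmul h3 (hpw 2 hb6)) (by norm_num)) (hwk (hmul (hmul h18 hb4') hb8') (by norm_num)))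
      (hwk (hmul (hmul (hmul h18 hb4') hb6) hx'0) (by norm_num)))
      (hwk (hmul (hmul (hmul h2 hb2') hb8') hx'0) (by norm_num)))
      (hwk (hmul (hmul hb2' hb4') hb6) (by norm_num))) (hwk (hmul (hpw 2 hb2') hb8') (by norm_num))
  have hc2 : v (-4 * W.b₆ * W.b₈ - 9 * W.b₆ ^ 2 * x' - 6 * W.b₄ * W.b₈ * x' + 2 * W.b₄ ^ 2 * W.b₆ +
      W.b₂ * W.b₆ ^ 2 - 3 * W.b₂ * W.b₄ * W.b₈) ≤ t ^ 4 :=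
    Valuation.map_sub_le _ (Valuation.map_add_le _ (Valuation.map_add_le _ (Valuation.map_sub_le _
      (Valuation.map_sub_le _
      (hwk (hmul (hmul (hng h4) hb6) hb8') (by norm_num)) (hwk (hmul (hmul h9 (hpw 2 hb6)) hx'0) (by norm_num)))
      (hwk (hmul (hmul (hmul h6 hb4') hb8') hx'0) (by norm_num)))
      (hwk (hmul (hmul h2 (hpw 2 hb4')) hb6) (by norm_num)))
      (hwk (hmul hb2' (hpw 2 hb6)) (by norm_num))) (hwk (hmul (hmul (hmul h3 hb2') hb4') hb8') (by norm_num))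
  have hc1 : v (W.b₈ ^ 2 - 6 * W.b₆ * W.b₈ * x' + 3 * W.b₄ * W.b₆ ^ 2 - 2 * W.b₄ ^ 2 * W.b₈ -
      W.b₂ * W.b₆ * W.b₈) ≤ t ^ 4 :=
    Valuation.map_sub_le _ (Valuation.map_sub_le _ (Valuation.map_add_le _ (Valuation.map_sub_le _
      (hwk (hpw 2 hb8') (by norm_num)) (hwk (hmul (hmul (hmul h6 hb6) hb8') hx'0) (by norm_num)))
      (hwk (hmul (hmul h3 hb4') (hpw 2 hb6)) (by norm_num)))
      (hwk (hmul (hmul h2 (hpw 2 hb4')) hb8') (by norm_num))) (hwk (hmul (hmul hb2' hb6) hb8') (by norm_num))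
  -- the constant coefficient: `v(c₀) = B` exactly
  have hc0 : v (-(x' * W.b₈ ^ 2) + (W.b₆ ^ 3 - W.b₄ * W.b₆ * W.b₈)) = β ^ 9 := by
    have hmain : v (-(x' * W.b₈ ^ 2)) = B := by
      rw [Valuation.map_neg, map_mul, map_pow, hb8, ← pow_mul]
    have hrest : v (W.b₆ ^ 3 - W.b₄ * W.b₆ * W.b₈) < v (-(x' * W.b₈ ^ 2)) := by
      rw [hmain]
      have hr : v (W.b₆ ^ 3 - W.b₄ * W.b₆ * W.b₈) ≤ t ^ 5 :=
        Valuation.map_sub_le _ (hwk (hpw 3 hb6) (by norm_num)) (hwk (hmul (hmul hb4' hb6) hb8') (by norm_num))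
      refine hr.trans_lt ?_
      calc t ^ 5 = t * t ^ 4 := by rw [← pow_succ']
        _ < w * t ^ 4 := mul_lt_mul_right_of_ne_zero' (pow_ne_zero _ ht0) htw
    rw [Valuation.map_add_eq_of_lt_left _ hrest, hmain, hβ9]
  -- assemble
  have hzero : x ^ 9 + ((-9 * x') * x ^ 8 + (-6 * W.b₄ - 6 * W.b₂ * x') * x ^ 7 +
      (-24 * W.b₆ - 18 * W.b₄ * x' - W.b₂ * W.b₄ - W.b₂ ^ 2 * x') * x ^ 6 +
      (-34 * W.b₈ - 18 * W.b₆ * x' - W.b₄ ^ 2 - 5 * W.b₂ * W.b₆ - 6 * W.b₂ * W.b₄ * x') * x ^ 5 +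
      (-6 * W.b₈ * x' - 3 * W.b₄ * W.b₆ - 9 * W.b₄ ^ 2 * x' - 12 * W.b₂ * W.b₈ -
        6 * W.b₂ * W.b₆ * x') * x ^ 4 +
      (3 * W.b₆ ^ 2 - 18 * W.b₄ * W.b₈ - 18 * W.b₄ * W.b₆ * x' - 2 * W.b₂ * W.b₈ * x' +
        W.b₂ * W.b₄ * W.b₆ - W.b₂ ^ 2 * W.b₈) * x ^ 3 +
      (-4 * W.b₆ * W.b₈ - 9 * W.b₆ ^ 2 * x' - 6 * W.b₄ * W.b₈ * x' + 2 * W.b₄ ^ 2 * W.b₆ +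
        W.b₂ * W.b₆ ^ 2 - 3 * W.b₂ * W.b₄ * W.b₈) * x ^ 2 +
      (W.b₈ ^ 2 - 6 * W.b₆ * W.b₈ * x' + 3 * W.b₄ * W.b₆ ^ 2 - 2 * W.b₄ ^ 2 * W.b₈ -
        W.b₂ * W.b₆ * W.b₈) * x +
      (-(x' * W.b₈ ^ 2) + (W.b₆ ^ 3 - W.b₄ * W.b₆ * W.b₈))) = 0 := by
    rw [← eval_Φ_three_sub_mul_Ψ₃_sq, ← hrel]; ring
  have hres := valuation_eq_of_monic_relation_nine v hβ0 hc0
    (bound hc1 (by norm_num)) (bound hc2 (by norm_num)) (bound hc3 (by norm_num))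
    (bound hc4 (by norm_num)) (bound hc5 (by norm_num)) (bound hc6 (by norm_num))
    (bound hc7 (by norm_num)) (bound hc8 (by norm_num)) hzero
  rw [hres, hβ9]

end Summit.BirchSwinnertonDyer.Rank1Residual.GaloisImage

end
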